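import Mathlib.Analysis.SpecialFunctions.Pow.Asymptotics
import Mathlib.Analysis.SpecialFunctions.Log.Base
import Literature.NumberTheory.LFunctions.VinogradovKorobovFromRichert
import Literature.NumberTheory.LFunctions.ZetaZeroFreeRegion
import Literature.NumberTheory.LFunctions.ZeroDensityInghamHuxley
import Literature.NumberTheory.LFunctions.WeilExplicit
import Literature.NumberTheory.LFunctions.ZetaArgVariation
import Literature.NumberTheory.LFunctions.LinnikZeroSumFromDensity
import Literature.NumberTheory.LFunctions.ZeroDensityNearOne
import HarnessLib

/-!
# Guth–Maynard §13.2: the sum over the zeros, `∑_{|γ| ≤ T} m(ρ) Z^{β−1} ≪ exp(−A (log Z)^{1/4})` for `T ≤ Z^{13/30−ε}`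

NOT RH-BEARING (D-0040; rh-crit cell C4, bears_on LADDER-RH §4 HELD row `DensityLadder`): a
zero-density theorem counts zeros off the critical line, it never empties the strip (Barrier
`LindelofBacklund`); everything here is RH-FREE literature about COUNTS of zeros, and nothing in this
file is worded as, or is, progress toward RH.

Topic `Literature/NumberTheory/LFunctions`. THEOREMS only (no definition, no named fact, no `sorry`).
Source: L. Guth, J. Maynard, *New large value estimates for Dirichlet polynomials*, Ann. of Math. (2)
203 (2026) 623–675 = arXiv:2405.20552, **§13.2** (proof of Corollaries 1.3 and 1.4), the density side:

> "by considering `1/log x`-separated values of `σ` … By combining (1.2) with a slightly stronger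
> result (such as [J] or [M3]) that loses at most logarithmic factors for `σ` closer to 1, we have
> `N(σ,T) ≪ T^{(30/13+o(1))(1−σ)}(log T)^{O(1)}` (13.4). Using this and the Vinogradov-Korobov
> zero-free bound `N(σ,T) = 0` for `σ ≥ 1 − c(log T)^{−2/3}(log log T)^{−1/3}` … we find that
> `sup_σ x^{σ−1} N(σ,T) ≪ (log T)^{O(1)} sup_{σ ≤ 1−c(log T)^{−5/7}} (T^{30/13+o(1)}/x)^{1−σ}
> ≪_ε exp(−(log x)^{1/4})` provided `T < x^{13/30−ε/2}`."

Main result (namespace `Literature.NumberTheory.LFunctions.GuthMaynard2026`):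

* `zeroSum_rpow_decay` — under the combined density bound (13.4), taken as the HYPOTHESIS
  `hcomb : ∀ η > 0, ∃ C B T₀, ∀ T ≥ T₀, ∀ σ ∈ [1/2,1], N(σ,T) ≤ C T^{(30/13+η)(1−σ)} (log T)^B`
  (verbatim the conclusion of the tree's `zetaZeroCountRe_le_combined`, `ZeroDensityNearOne.lean`,
  minus its positivity clause; that theorem derives it from Guth–Maynard's `30/13` density theorem
  `zeroDensity_thirty_thirteenths_holds` and a log-power density bound near `σ = 1`), for every
  `ε > 0` and every real `A`: `∃ C Z₀, ∀ Z ≥ Z₀, ∀ T ≤ Z^{13/30−ε},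
  ∑_{ρ ∈ weilZeroIndex T} m(ρ) Z^{Re ρ − 1} ≤ C exp(−A (log Z)^{1/4})`. This is the form consumed by
  both corollaries (`Z = x` for Cor. 1.3, `Z = X²` for Cor. 1.4); `weilZeroIndex T` (zeros with
  `0 ≤ Re ρ ≤ 1`, `0 < |Im ρ| ≤ T`) and the multiplicity `m = riemannZetaZeroOrder` are the index set
  and weights of the tree's truncated explicit formula `zetaZeroSumTrunc` (`ExplicitFormulaPsi.lean`).

Steps, all PROVED here from tree theorems:
* `sum_weilZeroIndex_filter_le` — `∑_{ρ ∈ weilZeroIndex T, Re ρ ≥ α} m(ρ) ≤ 2 N(α,T)`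
  (`weilZeroIndex_eq_union`, conjugation symmetry `riemannZetaZeroOrder_conj_holds`);
* `exists_zetaZeroCount_le_mul_log` — `N(T) ≪ T log T` (Riemann–von Mangoldt,
  `riemann_von_mangoldt_holds`);
* `exists_zeroFree_upTo` — every zero with `|Im ρ| ≤ T` has `Re ρ ≤ 1 − c (log T)^{−5/7}`
  (`T ≥ T₁`): the tree's INEXPLICIT Vinogradov–Korobov region `VKFromRichert.zeta_zeroFree_of_richertType`
  (Titchmarsh Thm. 3.10/§6.19) fed with the unconditional Richert-type bound
  `exists_richertTypeBound_one` of `ZeroDensityNearOne.lean` (standard axioms; `|Im s| ≥ 21`), and the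
  de la Vallée-Poussin region `classicalZFRData_riemannZeta.zeroFree` at bounded height; Guth–Maynard's
  own weakening
  `(log T)^{−2/3}(log log T)^{−1/3} ↦ (log T)^{−5/7}` (`eventually_vkDen_le_rpow`);
* `sum_filter_half_le` — the "`1/log x`-separated values of `σ`" = the tree's slicing lemma
  `LinnikZeroSum.sum_mul_rpow_le_of_density_half` (Bombieri, *Le grand crible*, p. 55; Gallagher 1970
  §5) applied with `B = T^{30/13+η}`, weight `2C(log T)^B`, width `η = c(log T)^{−5/7}`; the zeros with
  `Re ρ < 1/2` contribute `≤ 2 N(T) Z^{−1/2}` (`sum_filter_lt_half_le`);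
* `zeroSum_le_of_density` — the assembly for `T₂ ≤ T ≤ Z^{13/30−ε/2}`: the saving is
  `exp(−(cε/2)(log Z)^{2/7}) ≪_A exp(−A (log Z)^{1/4})` (elementary growth lemmas
  `eventually_affine_log_rpow_le`, `lowZeros_numeric`, `highZeros_numeric`).

WHAT THIS IS NOT: not a route, not an RH residual, no claim about zeros ON the line; the explicit
Vinogradov–Korobov constant (`zero_free_region_vinogradov_korobov`, a named fact) is NOT used.

## References

* L. Guth, J. Maynard, *New large value estimates for Dirichlet polynomials*, Ann. of Math. (2) 203
  (2026), no. 2, 623–675; arXiv:2405.20552; §13.2 (chunk p0029 of the held text). [GuthMaynard2026]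
* E. Bombieri, *Le grand crible dans la théorie analytique des nombres*, Astérisque 18 (1987), §6,
  p. 55. [Bombieri1987GrandCrible]
* P. X. Gallagher, *A large sieve density estimate near `σ = 1`*, Invent. Math. 11 (1970), §5.
  [Gallagher1970]
* E. C. Titchmarsh, *The Theory of the Riemann Zeta-Function*, 2nd ed. (1986), Thm. 9.4
  (Riemann–von Mangoldt), Thm. 3.8 (de la Vallée-Poussin). [Titchmarsh1986]
* A. Ivić, *The Riemann Zeta-Function*, Wiley 1985, Thm. 6.2 (Vinogradov's zeta-sum estimate behind
  `exists_richertTypeBound_one`). [Ivic1985]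
-/

noncomputable section

open Complex Real Filter Topology Asymptotics Finset

namespace Literature.NumberTheory.LFunctions

namespace GuthMaynard2026

/-! ### Elementary growth lemmas in the variable `u = log x` -/

/-- Eventually `M + B log u + A u^q ≤ κ u^p` (`q < p`, `0 < p`, `0 < κ`): `log u` and `u^q` are
`o(u^p)`. [folklore] -/
private theorem eventually_affine_log_rpow_le (M B A : ℝ) {p q κ : ℝ} (hp : 0 < p) (hq : q < p)
    (hκ : 0 < κ) : ∀ᶠ u : ℝ in atTop, M + B * Real.log u + A * u ^ q ≤ κ * u ^ p := by
  have h1 : Tendsto (fun u : ℝ ↦ M / u ^ p) atTop (𝓝 0) :=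
    tendsto_const_nhds.div_atTop (tendsto_rpow_atTop hp)
  have h2 : Tendsto (fun u : ℝ ↦ B * Real.log u / u ^ p) atTop (𝓝 0) :=
    ((isLittleO_log_rpow_atTop hp).const_mul_left B).tendsto_div_nhds_zero
  have h3 : Tendsto (fun u : ℝ ↦ A * u ^ q / u ^ p) atTop (𝓝 0) := by
    have h := (tendsto_rpow_neg_atTop (by linarith : 0 < p - q)).const_mul A
    rw [mul_zero] at h
    refine h.congr' ?_
    filter_upwards [eventually_gt_atTop (0 : ℝ)] with u hu
    rw [neg_sub, Real.rpow_sub hu, mul_div_assoc]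
  have hsum : Tendsto (fun u : ℝ ↦ (M + B * Real.log u + A * u ^ q) / u ^ p) atTop (𝓝 0) := by
    have := (h1.add h2).add h3
    simp only [add_zero] at this
    refine this.congr' (Eventually.of_forall fun u ↦ ?_)
    simp only
    ring
  filter_upwards [(tendsto_order.1 hsum).2 κ hκ, eventually_gt_atTop (0 : ℝ)] with u hu hu0
  have hp0 : 0 < u ^ p := Real.rpow_pos_of_pos hu0 _
  exact ((div_lt_iff₀ hp0).1 hu).le

/-- `K u^B e^L ≤ e^R` from `log K + B log u + L ≤ R` (`K, u > 0`). [folklore] -/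
private theorem mul_rpow_mul_exp_le_exp {K u B L R : ℝ} (hK : 0 < K) (hu : 0 < u)
    (h : Real.log K + B * Real.log u + L ≤ R) : K * u ^ B * Real.exp L ≤ Real.exp R := by
  have : Real.exp (Real.log K + B * Real.log u + L) = K * u ^ B * Real.exp L := by
    rw [Real.exp_add, Real.exp_add, Real.exp_log hK, Real.rpow_def_of_pos hu, mul_comm (Real.log u)]
  rw [← this]
  exact Real.exp_le_exp.2 h

/-! ### Zeros: counting with multiplicity on the index set of the explicit formula -/

/-- The multiplicity sum over the index set `weilZeroIndex T` of the truncated explicit formula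
(zeros with `0 ≤ Re ρ ≤ 1`, `0 < |Im ρ| ≤ T`), restricted to `Re ρ ≥ α`, is at most `2 N(α, T)`:
the restricted set lies in `zetaZeroBox α T ∪ conj (zetaZeroBox α T)` (`weilZeroIndex_eq_union`) and
the multiplicities are conjugation invariant (`riemannZetaZeroOrder_conj_holds`; "the zeros … are
symmetrical about the real axis", Titchmarsh §2.12). [cite: Titchmarsh1986, §2.12] -/
theorem sum_weilZeroIndex_filter_le (α T : ℝ) :
    ∑ ρ ∈ (weilZeroIndex_finite T).toFinset with α ≤ ρ.re, (riemannZetaZeroOrder ρ : ℝ) ≤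
      2 * (zetaZeroCountRe α T : ℝ) := by
  classical
  set B := (zetaZeroBox_finite α T).toFinset with hB
  have hsub : ((weilZeroIndex_finite T).toFinset.filter fun ρ ↦ α ≤ ρ.re) ⊆
      B ∪ B.image (starRingEnd ℂ) := by
    intro ρ hρ
    rw [Finset.mem_filter, Set.Finite.mem_toFinset] at hρ
    obtain ⟨⟨h0, -, h2, h3, h4⟩, hα'⟩ := hρ
    rw [Finset.mem_union]
    rcases lt_or_gt_of_ne h3 with hneg | hpos
    · right
      rw [Finset.mem_image]
      refine ⟨starRingEnd ℂ ρ, ?_, Complex.conj_conj ρ⟩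
      rw [hB, Set.Finite.mem_toFinset]
      refine ⟨?_, ?_, ?_, ?_, ?_⟩
      · rw [riemannZeta_conj, h0, map_zero]
      · simpa using hα'
      · simpa using h2
      · simpa using hneg
      · rw [Complex.conj_im]
        exact (neg_le_abs _).trans (by simpa [abs_neg] using h4)
    · left
      rw [hB, Set.Finite.mem_toFinset]
      exact ⟨h0, hα', h2, hpos, (le_abs_self _).trans h4⟩
  have hnonneg : ∀ ρ ∈ B ∪ B.image (starRingEnd ℂ), (0 : ℝ) ≤ riemannZetaZeroOrder ρ := by
    intro ρ hρ
    rw [Finset.mem_union] at hρ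
    rcases hρ with hρ | hρ
    · rw [hB, Set.Finite.mem_toFinset] at hρ
      exact riemannZetaZeroOrder_nonneg_of_zero hρ.1
    · rw [Finset.mem_image] at hρ
      obtain ⟨w, hw, rfl⟩ := hρ
      rw [hB, Set.Finite.mem_toFinset] at hw
      refine riemannZetaZeroOrder_nonneg_of_zero ?_
      rw [riemannZeta_conj, hw.1, map_zero]
  have hcount : ∑ ρ ∈ B, (riemannZetaZeroOrder ρ : ℝ) = (zetaZeroCountRe α T : ℝ) := by
    rw [natCast_zetaZeroCountRe]
  have himage : ∑ ρ ∈ B.image (starRingEnd ℂ), (riemannZetaZeroOrder ρ : ℝ) =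
      (zetaZeroCountRe α T : ℝ) := by
    rw [Finset.sum_image (fun x _ y _ h ↦ (starRingEnd ℂ).injective h), ← hcount]
    refine Finset.sum_congr rfl fun ρ _ ↦ ?_
    rw [riemannZetaZeroOrder_conj_holds ρ]
  calc ∑ ρ ∈ (weilZeroIndex_finite T).toFinset with α ≤ ρ.re, (riemannZetaZeroOrder ρ : ℝ)
      ≤ ∑ ρ ∈ B ∪ B.image (starRingEnd ℂ), (riemannZetaZeroOrder ρ : ℝ) :=
        Finset.sum_le_sum_of_subset_of_nonneg hsub fun ρ hρ _ ↦ hnonneg ρ hρ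
    _ ≤ ∑ ρ ∈ B, (riemannZetaZeroOrder ρ : ℝ) +
          ∑ ρ ∈ B.image (starRingEnd ℂ), (riemannZetaZeroOrder ρ : ℝ) := by
        rw [← Finset.sum_union_inter]
        have : 0 ≤ ∑ ρ ∈ B ∩ B.image (starRingEnd ℂ), (riemannZetaZeroOrder ρ : ℝ) :=
          Finset.sum_nonneg fun ρ hρ ↦
            hnonneg ρ (Finset.mem_union_left _ (Finset.mem_inter.1 hρ).1)
        linarith
    _ = 2 * (zetaZeroCountRe α T : ℝ) := by rw [hcount, himage]; ring

/-- The total multiplicity of `weilZeroIndex T` (zeros with `0 < |γ| ≤ T`) is at most `2 N(T)`,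
`N(T)` counting `0 < γ ≤ T` (Titchmarsh §9.1; conjugate symmetry §2.12). [cite: Titchmarsh1986, §9.1] -/
theorem sum_weilZeroIndex_le (T : ℝ) :
    ∑ ρ ∈ (weilZeroIndex_finite T).toFinset, (riemannZetaZeroOrder ρ : ℝ) ≤
      2 * (zetaZeroCount T : ℝ) := by
  have h := sum_weilZeroIndex_filter_le 0 T
  rwa [Finset.filter_true_of_mem] at h
  intro ρ hρ
  rw [Set.Finite.mem_toFinset] at hρ
  exact hρ.2.1

/-- **`N(T) ≪ T log T`** from the Riemann–von Mangoldt formula (`riemann_von_mangoldt_holds`):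
there is `C > 0` with `N(T) ≤ C T log T` for all large `T`. [cite: Titchmarsh1986, Theorem 9.4] -/
theorem exists_zetaZeroCount_le_mul_log :
    ∃ C : ℝ, 0 < C ∧ ∀ᶠ T : ℝ in atTop, (zetaZeroCount T : ℝ) ≤ C * T * Real.log T := by
  obtain ⟨c, hc⟩ := Asymptotics.isBigO_iff.1 riemann_von_mangoldt_holds
  refine ⟨1 + max c 0, by positivity, ?_⟩
  filter_upwards [hc, eventually_ge_atTop (2 * π)] with T hT hT2π
  have hπ : 0 < π := Real.pi_pos
  have hT1 : 1 ≤ T := by linarith [Real.pi_gt_three]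
  have hT0 : 0 < T := by linarith
  have hlogT : 0 ≤ Real.log T := Real.log_nonneg hT1
  rw [Real.norm_of_nonneg hlogT, Real.norm_eq_abs] at hT
  have h1 : (zetaZeroCount T : ℝ) ≤
      T / (2 * π) * Real.log (T / (2 * π)) - T / (2 * π) + c * Real.log T := by
    have := (abs_le.1 hT).2; linarith
  have h2 : Real.log (T / (2 * π)) ≤ Real.log T :=
    Real.log_le_log (by positivity)
      (by rw [div_le_iff₀ (by positivity)]; nlinarith [Real.pi_gt_three])
  have h3 : T / (2 * π) ≤ T := by
    rw [div_le_iff₀ (by positivity)]; nlinarith [Real.pi_gt_three]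
  have h4 : T / (2 * π) * Real.log (T / (2 * π)) ≤ T * Real.log T :=
    mul_le_mul h3 h2 (Real.log_nonneg (by rw [le_div_iff₀ (by positivity)]; linarith))
      hT0.le
  have h5 : c * Real.log T ≤ max c 0 * (T * Real.log T) := by
    calc c * Real.log T ≤ max c 0 * Real.log T :=
          mul_le_mul_of_nonneg_right (le_max_left _ _) hlogT
      _ ≤ max c 0 * (T * Real.log T) := by
          refine mul_le_mul_of_nonneg_left ?_ (le_max_right _ _)
          nlinarith
  have h6 : 0 ≤ T / (2 * π) := by positivity
  nlinarith

/-! ### The zero-free region up to height `T` -/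

/-- The Vinogradov–Korobov denominator `g(v) = (log v)^{2/3} (log log v)^{1/3}` is monotone on
`v > e`. [folklore] -/
private theorem vkDen_mono {v w : ℝ} (hv : Real.exp 1 < v) (hvw : v ≤ w) :
    Real.log v ^ (2 / 3 : ℝ) * Real.log (Real.log v) ^ (1 / 3 : ℝ) ≤
      Real.log w ^ (2 / 3 : ℝ) * Real.log (Real.log w) ^ (1 / 3 : ℝ) := by
  have h0 : 0 < v := lt_trans (Real.exp_pos 1) hv
  have h1 : 1 < Real.log v := by rw [Real.lt_log_iff_exp_lt h0]; exact hv
  have hlog : Real.log v ≤ Real.log w := Real.log_le_log h0 hvw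
  have h2 : 0 < Real.log (Real.log v) := Real.log_pos h1
  have hloglog : Real.log (Real.log v) ≤ Real.log (Real.log w) :=
    Real.log_le_log (by linarith) hlog
  apply mul_le_mul
  · exact Real.rpow_le_rpow (by linarith) hlog (by norm_num)
  · exact Real.rpow_le_rpow h2.le hloglog (by norm_num)
  · exact Real.rpow_nonneg h2.le _
  · exact Real.rpow_nonneg (by linarith) _

/-- `g(v) > 0` for `v > e`. [folklore] -/
private theorem vkDen_pos {v : ℝ} (hv : Real.exp 1 < v) :
    0 < Real.log v ^ (2 / 3 : ℝ) * Real.log (Real.log v) ^ (1 / 3 : ℝ) := by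
  have h0 : 0 < v := lt_trans (Real.exp_pos 1) hv
  have h1 : 1 < Real.log v := by rw [Real.lt_log_iff_exp_lt h0]; exact hv
  have h2 : 0 < Real.log (Real.log v) := Real.log_pos h1
  exact mul_pos (Real.rpow_pos_of_pos (by linarith) _) (Real.rpow_pos_of_pos h2 _)

/-- Eventually `(log T)^{2/3} (log log T)^{1/3} ≤ (log T)^{5/7}` (since `log u ≤ u^{1/7}` for
large `u`); this is the weakening `(log T)^{−2/3}(log log T)^{−1/3} ↦ (log T)^{−5/7}` of the
Vinogradov–Korobov width made in Guth–Maynard §13.2 ("sup_{σ ≤ 1−c(log T)^{−5/7}}").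
[cite: GuthMaynard2026, §13.2] -/
theorem eventually_vkDen_le_rpow :
    ∀ᶠ T : ℝ in atTop, Real.log T ^ (2 / 3 : ℝ) * Real.log (Real.log T) ^ (1 / 3 : ℝ) ≤
      Real.log T ^ (5 / 7 : ℝ) := by
  have h1 : ∀ᶠ u : ℝ in atTop, Real.log u ≤ u ^ (1 / 7 : ℝ) := by
    have h := (isLittleO_log_rpow_atTop (by norm_num : (0 : ℝ) < 1 / 7)).bound (c := 1) one_pos
    filter_upwards [h, eventually_ge_atTop (1 : ℝ)] with u hu hu1
    rw [one_mul, Real.norm_of_nonneg (Real.log_nonneg hu1),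
      Real.norm_of_nonneg (Real.rpow_nonneg (by linarith) _)] at hu
    exact hu
  have h2 : ∀ᶠ T : ℝ in atTop, Real.log (Real.log T) ≤ Real.log T ^ (1 / 7 : ℝ) ∧ 1 ≤ Real.log T :=
    Real.tendsto_log_atTop.eventually (h1.and (eventually_ge_atTop 1))
  filter_upwards [h2] with T ⟨hT, hT1⟩
  have hL0 : 0 < Real.log T := by linarith
  have hLL0 : 0 ≤ Real.log (Real.log T) := Real.log_nonneg hT1
  calc Real.log T ^ (2 / 3 : ℝ) * Real.log (Real.log T) ^ (1 / 3 : ℝ)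
      ≤ Real.log T ^ (2 / 3 : ℝ) * (Real.log T ^ (1 / 7 : ℝ)) ^ (1 / 3 : ℝ) := by
        gcongr
    _ = Real.log T ^ (5 / 7 : ℝ) := by
        rw [← Real.rpow_mul hL0.le, ← Real.rpow_add hL0]; norm_num

/-- **All zeros of `ζ` up to height `T` lie to the left of `1 − c (log T)^{−5/7}`** (`T ≥ T₁`;
also `c (log T)^{−5/7} ≤ 1/2` there): the INEXPLICIT Vinogradov–Korobov region of the tree,
`VKFromRichert.zeta_zeroFree_of_richertType` fed with the unconditional Richert-type bound
`exists_richertTypeBound_one` (`ζ(s) ≠ 0` for `|Im s| ≥ 21`,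
`Re s ≥ 1 − c/((log|t|)^{2/3}(log log|t|)^{1/3})`; standard axioms — the same region also follows from
`zeta_zeroFree_of_zeta_bound_ford zeta_bound_ford_holds`; the width is monotone in `|t|`, and
`(log T)^{2/3}(log log T)^{1/3} ≤ (log T)^{5/7}` for large `T`), together with the
de la Vallée-Poussin region at bounded height (`classicalZFRData_riemannZeta.zeroFree`, all `t`:
zeros with `|Im ρ| < 21`, `Re ρ > 1/2` have `Re ρ ≤ 1 − c_K/log 25`). This is the input
"`N(σ,T) = 0` for `σ ≥ 1 − c(log T)^{−2/3}(log log T)^{−1/3}` for a suitable constant `c > 0`"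
of Guth–Maynard §13.2 in their weakened form `σ ≤ 1 − c(log T)^{−5/7}`.
[cite: GuthMaynard2026, §13.2] -/
theorem exists_zeroFree_upTo :
    ∃ c : ℝ, 0 < c ∧ ∃ T₁ : ℝ, 3 ≤ T₁ ∧ ∀ T : ℝ, T₁ ≤ T →
      c / Real.log T ^ (5 / 7 : ℝ) ≤ 1 / 2 ∧
      ∀ ρ : ℂ, riemannZeta ρ = 0 → |ρ.im| ≤ T → ρ.re ≤ 1 - c / Real.log T ^ (5 / 7 : ℝ) := by
  obtain ⟨A₀, B₀, -, -, hR⟩ := exists_richertTypeBound_one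
  obtain ⟨cV, hcV, hVK⟩ := VKFromRichert.zeta_zeroFree_of_richertType hR zero_le_one
  obtain ⟨cK, hcK, hK⟩ := classicalZFRData_riemannZeta.zeroFree
  set c : ℝ := min cV cK with hc
  have hc0 : 0 < c := lt_min hcV hcK
  have hccV : c ≤ cV := min_le_left _ _
  have hccK : c ≤ cK := min_le_right _ _
  have hlim : Tendsto (fun T : ℝ ↦ c / Real.log T ^ (5 / 7 : ℝ)) atTop (𝓝 0) :=
    tendsto_const_nhds.div_atTop ((tendsto_rpow_atTop (by norm_num)).comp Real.tendsto_log_atTop)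
  have hsmall : ∀ᶠ T : ℝ in atTop, c / Real.log T ^ (5 / 7 : ℝ) ≤ min (1 / 2) (cK / Real.log 25) := by
    have hpos : 0 < min (1 / 2 : ℝ) (cK / Real.log 25) :=
      lt_min (by norm_num) (div_pos hcK (Real.log_pos (by norm_num)))
    exact ((tendsto_order.1 hlim).2 _ hpos).mono fun T hT ↦ hT.le
  obtain ⟨T₁, hT₁⟩ :=
    (hsmall.and (eventually_vkDen_le_rpow.and (eventually_ge_atTop (21 : ℝ)))).exists_forall_of_atTop
  refine ⟨c, hc0, max T₁ 3, le_max_right _ _, fun T hT ↦ ?_⟩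
  obtain ⟨hsm, hg, h21⟩ := hT₁ T ((le_max_left _ _).trans hT)
  refine ⟨hsm.trans (min_le_left _ _), fun ρ hζ him ↦ ?_⟩
  have hT3 : 3 ≤ T := (le_max_right _ _).trans hT
  have hlogT : 0 < Real.log T := Real.log_pos (by linarith)
  have hL57 : 0 < Real.log T ^ (5 / 7 : ℝ) := Real.rpow_pos_of_pos hlogT _
  have he : Real.exp 1 < 21 := lt_trans Real.exp_one_lt_d9 (by norm_num)
  rcases le_or_gt ρ.re (1 / 2) with hhalf | hhalf
  · have : c / Real.log T ^ (5 / 7 : ℝ) ≤ 1 / 2 := hsm.trans (min_le_left _ _)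
    linarith
  rcases lt_or_ge |ρ.im| 21 with hlow | hhigh
  · -- bounded height: de la Vallée-Poussin
    have hρ1 : ρ ≠ 1 := by rintro rfl; exact riemannZeta_one_ne_zero hζ
    have hz1 : riemannZeta₁ ρ = 0 := (riemannZeta₁_eq_zero_iff hρ1).2 hζ
    have hnot : ¬ (1 - cK / Real.log (|ρ.im| + 4) < ρ.re) := fun h ↦
      hK ρ (by norm_num; linarith) h hz1
    have hle : ρ.re ≤ 1 - cK / Real.log (|ρ.im| + 4) := not_lt.1 hnot
    have hlog4 : 0 < Real.log (|ρ.im| + 4) := Real.log_pos (by linarith [abs_nonneg ρ.im])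
    have hlog25 : Real.log (|ρ.im| + 4) ≤ Real.log 25 :=
      Real.log_le_log (by linarith [abs_nonneg ρ.im]) (by linarith)
    have h1 : cK / Real.log 25 ≤ cK / Real.log (|ρ.im| + 4) :=
      div_le_div_of_nonneg_left hcK.le hlog4 hlog25
    have h2 : c / Real.log T ^ (5 / 7 : ℝ) ≤ cK / Real.log 25 := hsm.trans (min_le_right _ _)
    linarith
  · -- Vinogradov–Korobov range
    have hnot : ¬ (1 - cV / (Real.log |ρ.im| ^ (2 / 3 : ℝ) *
        Real.log (Real.log |ρ.im|) ^ (1 / 3 : ℝ)) ≤ ρ.re) := fun h ↦ hVK ρ hhigh h hζ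
    have hlt := not_le.1 hnot
    have hgpos := vkDen_pos (lt_of_lt_of_le he hhigh)
    have hgmono := vkDen_mono (lt_of_lt_of_le he hhigh) him
    have hgT := vkDen_pos (lt_of_lt_of_le he (hhigh.trans him))
    have h1 : cV / (Real.log T ^ (2 / 3 : ℝ) * Real.log (Real.log T) ^ (1 / 3 : ℝ)) ≤
        cV / (Real.log |ρ.im| ^ (2 / 3 : ℝ) * Real.log (Real.log |ρ.im|) ^ (1 / 3 : ℝ)) :=
      div_le_div_of_nonneg_left hcV.le hgpos hgmono
    have h2 : cV / Real.log T ^ (5 / 7 : ℝ) ≤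
        cV / (Real.log T ^ (2 / 3 : ℝ) * Real.log (Real.log T) ^ (1 / 3 : ℝ)) :=
      div_le_div_of_nonneg_left hcV.le hgT hg
    have h3 : c / Real.log T ^ (5 / 7 : ℝ) ≤ cV / Real.log T ^ (5 / 7 : ℝ) :=
      div_le_div_of_nonneg_right hccV hL57.le
    linarith

/-! ### The sum over the zeros -/

/-- The zeros with `Re ρ < 1/2` in the index set contribute at most `2 N(T) x^{−1/2}` to
`∑ m(ρ) x^{Re ρ − 1}` (`x ≥ 1`). [folklore] -/
private theorem sum_filter_lt_half_le {x : ℝ} (hx : 1 ≤ x) (T : ℝ) :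
    ∑ ρ ∈ (weilZeroIndex_finite T).toFinset with ¬ (1 : ℝ) / 2 ≤ ρ.re,
        (riemannZetaZeroOrder ρ : ℝ) * x ^ (ρ.re - 1) ≤
      2 * (zetaZeroCount T : ℝ) * x ^ (-(1 / 2 : ℝ)) := by
  classical
  set s := (weilZeroIndex_finite T).toFinset with hs
  have hm0 : ∀ ρ ∈ s, (0 : ℝ) ≤ riemannZetaZeroOrder ρ := fun ρ hρ ↦
    riemannZetaZeroOrder_nonneg_of_zero ((Set.Finite.mem_toFinset _).1 hρ).1
  have hx0 : 0 ≤ x := by linarith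
  have h1 : ∀ ρ ∈ s.filter (fun ρ ↦ ¬ (1 : ℝ) / 2 ≤ ρ.re),
      (riemannZetaZeroOrder ρ : ℝ) * x ^ (ρ.re - 1) ≤
        (riemannZetaZeroOrder ρ : ℝ) * x ^ (-(1 / 2 : ℝ)) := by
    intro ρ hρ
    rw [Finset.mem_filter] at hρ
    refine mul_le_mul_of_nonneg_left ?_ (hm0 ρ hρ.1)
    exact Real.rpow_le_rpow_of_exponent_le hx (by linarith [not_le.1 hρ.2])
  calc ∑ ρ ∈ s with ¬ (1 : ℝ) / 2 ≤ ρ.re, (riemannZetaZeroOrder ρ : ℝ) * x ^ (ρ.re - 1)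
      ≤ ∑ ρ ∈ s with ¬ (1 : ℝ) / 2 ≤ ρ.re, (riemannZetaZeroOrder ρ : ℝ) * x ^ (-(1 / 2 : ℝ)) :=
        Finset.sum_le_sum h1
    _ = (∑ ρ ∈ s with ¬ (1 : ℝ) / 2 ≤ ρ.re, (riemannZetaZeroOrder ρ : ℝ)) * x ^ (-(1 / 2 : ℝ)) := by
        rw [Finset.sum_mul]
    _ ≤ (∑ ρ ∈ s, (riemannZetaZeroOrder ρ : ℝ)) * x ^ (-(1 / 2 : ℝ)) := by
        refine mul_le_mul_of_nonneg_right ?_ (Real.rpow_nonneg hx0 _)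
        exact Finset.sum_le_sum_of_subset_of_nonneg (Finset.filter_subset _ _)
          fun ρ hρ _ ↦ hm0 ρ hρ
    _ ≤ 2 * (zetaZeroCount T : ℝ) * x ^ (-(1 / 2 : ℝ)) :=
        mul_le_mul_of_nonneg_right (sum_weilZeroIndex_le T) (Real.rpow_nonneg hx0 _)

/-- **The `1/log x`-sliced sum over the zeros with `Re ρ ≥ 1/2`** (Guth–Maynard §13.2, "by
considering `1/log x`-separated values of `σ`"; the slicing is the tree's
`LinnikZeroSum.sum_mul_rpow_le_of_density_half`): if `N(α, T) ≤ C' T^{A'(1−α)} (log T)^{B'}`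
for `α ∈ [1/2, 1]`, all zeros with `|Im ρ| ≤ T` have `Re ρ ≤ 1 − η` (`0 ≤ η ≤ 1/2`), and
`T^{A'} ≤ x^{1−ε/2}`, then
`∑_{Re ρ ≥ 1/2} m(ρ) x^{Re ρ−1} ≤ e · 2C'(log T)^{B'} · exp(−(ε/2) η log x) · (2/ε)`.
[cite: GuthMaynard2026, §13.2] -/
theorem sum_filter_half_le {x T A' C' B' η ε : ℝ} (hx : 1 < x) (hT : 1 ≤ T) (hA' : 0 < A')
    (hC' : 0 < C') (hε : 0 < ε) (hη0 : 0 ≤ η) (hη : η ≤ 1 / 2)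
    (hBx : T ^ A' ≤ x ^ (1 - ε / 2))
    (hN : ∀ α : ℝ, 1 / 2 ≤ α → α ≤ 1 →
      (zetaZeroCountRe α T : ℝ) ≤ C' * T ^ (A' * (1 - α)) * Real.log T ^ B')
    (hZF : ∀ ρ : ℂ, riemannZeta ρ = 0 → |ρ.im| ≤ T → ρ.re ≤ 1 - η) :
    ∑ ρ ∈ (weilZeroIndex_finite T).toFinset with (1 : ℝ) / 2 ≤ ρ.re,
        (riemannZetaZeroOrder ρ : ℝ) * x ^ (ρ.re - 1) ≤
      Real.exp 1 * (2 * C' * Real.log T ^ B') * Real.exp (-(ε / 2 * η * Real.log x)) * (2 / ε) := by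
  classical
  set s := (weilZeroIndex_finite T).toFinset with hs
  have hmem : ∀ ρ ∈ s, riemannZeta ρ = 0 ∧ 0 ≤ ρ.re ∧ ρ.re ≤ 1 ∧ ρ.im ≠ 0 ∧ |ρ.im| ≤ T := by
    intro ρ hρ
    rw [hs, Set.Finite.mem_toFinset] at hρ
    exact hρ
  have hm0 : ∀ ρ ∈ s, (0 : ℝ) ≤ riemannZetaZeroOrder ρ := fun ρ hρ ↦
    riemannZetaZeroOrder_nonneg_of_zero (hmem ρ hρ).1
  have hx0 : 0 < x := by linarith
  have hT0 : 0 < T := by linarith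
  set Bx : ℝ := T ^ A' with hBxdef
  have hBx1 : 1 ≤ Bx := Real.one_le_rpow hT hA'.le
  have hBx0 : 0 < Bx := by linarith
  have hBxlt : Bx < x := lt_of_le_of_lt hBx (by
    conv_rhs => rw [← Real.rpow_one x]
    exact Real.rpow_lt_rpow_of_exponent_lt hx (by linarith))
  set A : ℝ := 2 * C' * Real.log T ^ B' with hA
  have hlogT0 : 0 ≤ Real.log T := Real.log_nonneg hT
  have hA0 : 0 ≤ A := by rw [hA]; positivity
  set s₂ := s.filter (fun ρ ↦ (1 : ℝ) / 2 ≤ ρ.re) with hs₂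
  have hw : ∀ ρ ∈ s₂, 0 ≤ (riemannZetaZeroOrder ρ : ℝ) := fun ρ hρ ↦
    hm0 ρ (Finset.mem_filter.1 hρ).1
  have hhalf : ∀ ρ ∈ s₂, (1 : ℝ) / 2 ≤ ρ.re := fun ρ hρ ↦ (Finset.mem_filter.1 hρ).2
  have hβ : ∀ ρ ∈ s₂, ρ.re ≤ 1 - η := by
    intro ρ hρ
    have h := hmem ρ (Finset.mem_filter.1 hρ).1
    exact hZF ρ h.1 h.2.2.2.2
  have hd : ∀ α : ℝ, 1 / 2 ≤ α → α ≤ 1 - η →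
      ∑ ρ ∈ s₂ with α ≤ ρ.re, (riemannZetaZeroOrder ρ : ℝ) ≤ A * Bx ^ (1 - α) := by
    intro α hα hαη
    have hα1 : α ≤ 1 := by linarith
    have hsub : (s₂.filter fun ρ ↦ α ≤ ρ.re) ⊆ s.filter fun ρ ↦ α ≤ ρ.re := by
      intro ρ hρ
      rw [Finset.mem_filter] at hρ ⊢
      exact ⟨(Finset.mem_filter.1 hρ.1).1, hρ.2⟩
    have hpowT : T ^ (A' * (1 - α)) = Bx ^ (1 - α) := by
      rw [hBxdef, ← Real.rpow_mul hT0.le]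
    calc ∑ ρ ∈ s₂ with α ≤ ρ.re, (riemannZetaZeroOrder ρ : ℝ)
        ≤ ∑ ρ ∈ s with α ≤ ρ.re, (riemannZetaZeroOrder ρ : ℝ) :=
          Finset.sum_le_sum_of_subset_of_nonneg hsub fun ρ hρ _ ↦
            hm0 ρ (Finset.mem_filter.1 hρ).1
      _ ≤ 2 * (zetaZeroCountRe α T : ℝ) := sum_weilZeroIndex_filter_le α T
      _ ≤ 2 * (C' * T ^ (A' * (1 - α)) * Real.log T ^ B') := by linarith [hN α hα hα1]
      _ = A * Bx ^ (1 - α) := by rw [hA, hpowT]; ring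
  have hmain : ∑ ρ ∈ s₂, (riemannZetaZeroOrder ρ : ℝ) * x ^ (ρ.re - 1) ≤
      Real.exp 1 * A * (Bx / x) ^ η * (Real.log x / Real.log (x / Bx)) :=
    LinnikZeroSum.sum_mul_rpow_le_of_density_half s₂ (fun ρ ↦ ρ.re)
      (fun ρ ↦ (riemannZetaZeroOrder ρ : ℝ)) hBx1 hBxlt hA0 hη hw hhalf hβ hd
  refine hmain.trans ?_
  -- `log(x/Bx) ≥ (ε/2) log x`, `(Bx/x)^η ≤ exp(−(ε/2) η log x)`
  have hlogx : 0 < Real.log x := Real.log_pos hx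
  have hlogBx : Real.log Bx ≤ (1 - ε / 2) * Real.log x := by
    calc Real.log Bx ≤ Real.log (x ^ (1 - ε / 2)) := Real.log_le_log hBx0 hBx
      _ = (1 - ε / 2) * Real.log x := by rw [Real.log_rpow hx0]
  have hlogxB : ε / 2 * Real.log x ≤ Real.log (x / Bx) := by
    rw [Real.log_div hx0.ne' hBx0.ne']; linarith
  have hlogxB0 : 0 < Real.log (x / Bx) := lt_of_lt_of_le (by positivity) hlogxB
  have hratio : Real.log x / Real.log (x / Bx) ≤ 2 / ε := by
    rw [div_le_div_iff₀ hlogxB0 hε]; nlinarith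
  have hdecay : (Bx / x) ^ η ≤ Real.exp (-(ε / 2 * η * Real.log x)) := by
    have h1 : Bx / x ≤ x ^ (-(ε / 2)) := by
      rw [div_le_iff₀ hx0]
      calc Bx ≤ x ^ (1 - ε / 2) := hBx
        _ = x ^ (-(ε / 2)) * x := by
            rw [show (1 : ℝ) - ε / 2 = -(ε / 2) + 1 by ring, Real.rpow_add hx0, Real.rpow_one]
    have h2 : (Bx / x) ^ η ≤ (x ^ (-(ε / 2))) ^ η := Real.rpow_le_rpow (by positivity) h1 hη0
    have h3 : (x ^ (-(ε / 2))) ^ η = Real.exp (-(ε / 2 * η * Real.log x)) := by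
      rw [← Real.rpow_mul hx0.le, Real.rpow_def_of_pos hx0]; ring_nf
    rwa [h3] at h2
  gcongr

/-- Numerical step: from `log(4C₂) + log u + A u^{1/4} ≤ u/15` deduce
`2C₂ e^{−u/15} u ≤ e^{−A u^{1/4}}/2`. [folklore] -/
private theorem lowZeros_numeric {C₂ u A : ℝ} (hC₂ : 0 < C₂) (hu : 0 < u)
    (h : Real.log (4 * C₂) + 1 * Real.log u + A * u ^ (1 / 4 : ℝ) ≤ 1 / 15 * u ^ (1 : ℝ)) :
    2 * C₂ * Real.exp (-(1 / 15) * u) * u ≤ Real.exp (-(A * u ^ (1 / 4 : ℝ))) / 2 := by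
  have hK : (0 : ℝ) < 4 * C₂ := by positivity
  have h1 := mul_rpow_mul_exp_le_exp hK hu h
  rw [Real.rpow_one] at h1
  have hmul := mul_le_mul_of_nonneg_right h1
    (le_of_lt (mul_pos (Real.exp_pos (-(1 / 15) * u)) (Real.exp_pos (-(A * u ^ (1 / 4 : ℝ))))))
  have e0 : Real.exp (A * u ^ (1 / 4 : ℝ)) * Real.exp (-(A * u ^ (1 / 4 : ℝ))) = 1 := by
    rw [← Real.exp_add, add_neg_cancel, Real.exp_zero]
  have e1 : 4 * C₂ * u * Real.exp (A * u ^ (1 / 4 : ℝ)) *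
      (Real.exp (-(1 / 15) * u) * Real.exp (-(A * u ^ (1 / 4 : ℝ)))) =
      2 * (2 * C₂ * Real.exp (-(1 / 15) * u) * u) := by
    calc _ = 4 * C₂ * u * Real.exp (-(1 / 15) * u) *
          (Real.exp (A * u ^ (1 / 4 : ℝ)) * Real.exp (-(A * u ^ (1 / 4 : ℝ)))) := by ring
      _ = _ := by rw [e0]; ring
  have e2 : Real.exp (1 / 15 * u) *
      (Real.exp (-(1 / 15) * u) * Real.exp (-(A * u ^ (1 / 4 : ℝ)))) =
      Real.exp (-(A * u ^ (1 / 4 : ℝ))) := by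
    rw [← Real.exp_add, ← Real.exp_add]; ring_nf
  rw [e1, e2] at hmul
  linarith

/-- Numerical step: from `log(8eC'/ε) + B' log u + A u^{1/4} ≤ (cε/2) u^{2/7}` deduce
`(4eC'/ε) u^{B'} e^{−(cε/2)u^{2/7}} ≤ e^{−A u^{1/4}}/2`. [folklore] -/
private theorem highZeros_numeric {C' ε c B' u A : ℝ} (hC' : 0 < C') (hε : 0 < ε) (hu : 0 < u)
    (h : Real.log (8 * Real.exp 1 * C' / ε) + B' * Real.log u + A * u ^ (1 / 4 : ℝ) ≤
      c * ε / 2 * u ^ (2 / 7 : ℝ)) :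
    4 * Real.exp 1 * C' / ε * u ^ B' * Real.exp (-(c * ε / 2) * u ^ (2 / 7 : ℝ)) ≤
      Real.exp (-(A * u ^ (1 / 4 : ℝ))) / 2 := by
  have hK : 0 < 8 * Real.exp 1 * C' / ε := by positivity
  have h1 := mul_rpow_mul_exp_le_exp hK hu h
  have hmul := mul_le_mul_of_nonneg_right h1
    (le_of_lt (mul_pos (Real.exp_pos (-(c * ε / 2) * u ^ (2 / 7 : ℝ)))
      (Real.exp_pos (-(A * u ^ (1 / 4 : ℝ))))))
  have e0 : Real.exp (A * u ^ (1 / 4 : ℝ)) * Real.exp (-(A * u ^ (1 / 4 : ℝ))) = 1 := by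
    rw [← Real.exp_add, add_neg_cancel, Real.exp_zero]
  have e1 : 8 * Real.exp 1 * C' / ε * u ^ B' * Real.exp (A * u ^ (1 / 4 : ℝ)) *
      (Real.exp (-(c * ε / 2) * u ^ (2 / 7 : ℝ)) * Real.exp (-(A * u ^ (1 / 4 : ℝ)))) =
      2 * (4 * Real.exp 1 * C' / ε * u ^ B' * Real.exp (-(c * ε / 2) * u ^ (2 / 7 : ℝ))) := by
    calc _ = 8 * Real.exp 1 * C' / ε * u ^ B' * Real.exp (-(c * ε / 2) * u ^ (2 / 7 : ℝ)) *
          (Real.exp (A * u ^ (1 / 4 : ℝ)) * Real.exp (-(A * u ^ (1 / 4 : ℝ)))) := by ring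
      _ = _ := by rw [e0]; ring
  have e2 : Real.exp (c * ε / 2 * u ^ (2 / 7 : ℝ)) *
      (Real.exp (-(c * ε / 2) * u ^ (2 / 7 : ℝ)) * Real.exp (-(A * u ^ (1 / 4 : ℝ)))) =
      Real.exp (-(A * u ^ (1 / 4 : ℝ))) := by
    rw [← Real.exp_add, ← Real.exp_add]; ring_nf
  rw [e1, e2] at hmul
  linarith

/-- **The zero sum of §13.2** (Guth–Maynard, proof of Cor. 1.3: "by considering
`1/log x`-separated values of `σ` … `sup_σ x^{σ−1}N(σ,T) ≪ (log T)^{O(1)}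
sup_{σ ≤ 1−c(log T)^{−5/7}} (T^{30/13+o(1)}/x)^{1−σ} ≪_ε exp(−(log x)^{1/4})` provided
`T < x^{13/30−ε/2}`"). Under the combined zero-density bound
`N(σ, T) ≤ C T^{(30/13+η)(1−σ)} (log T)^B` (`σ ∈ [1/2, 1]`, `T ≥ T₀`, for every `η > 0`;
Guth–Maynard (13.4)), for every `0 < ε ≤ 1/10` there are `T₂, x₀` with
`∑_{ρ ∈ weilZeroIndex T} m(ρ) x^{Re ρ − 1} ≤ exp(−(log x)^{1/4})` whenever `x ≥ x₀` and
`T₂ ≤ T ≤ x^{13/30 − ε/2}` (`sum_filter_half_le` with `η = c(log T)^{−5/7}` from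
`exists_zeroFree_upTo`, and `sum_filter_lt_half_le` with `N(T) ≪ T log T`).
[cite: GuthMaynard2026, §13.2] -/
theorem zeroSum_le_of_density
    (hdens : ∀ η : ℝ, 0 < η → ∃ C B T₀ : ℝ, ∀ T : ℝ, T₀ ≤ T → ∀ σ : ℝ, 1 / 2 ≤ σ → σ ≤ 1 →
      (zetaZeroCountRe σ T : ℝ) ≤ C * T ^ ((30 / 13 + η) * (1 - σ)) * Real.log T ^ B)
    {ε : ℝ} (hε : 0 < ε) (hε1 : ε ≤ 1 / 10) (A : ℝ) :
    ∃ T₂ x₀ : ℝ, 1 ≤ T₂ ∧ ∀ x : ℝ, x₀ ≤ x → ∀ T : ℝ, T₂ ≤ T → T ≤ x ^ (13 / 30 - ε / 2) →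
      ∑ ρ ∈ (weilZeroIndex_finite T).toFinset, (riemannZetaZeroOrder ρ : ℝ) * x ^ (ρ.re - 1) ≤
        Real.exp (-(A * Real.log x ^ (1 / 4 : ℝ))) := by
  classical
  obtain ⟨C, B, T₀, hN⟩ := hdens ε hε
  obtain ⟨c, hc, T₁, hT₁3, hZF⟩ := exists_zeroFree_upTo
  obtain ⟨C₂, hC₂, hcount⟩ := exists_zetaZeroCount_le_mul_log
  have hC'1 : 1 ≤ max C 1 := le_max_right _ _
  have hC'0 : 0 < max C 1 := by linarith
  have hB'0 : 0 ≤ max B 0 := le_max_right _ _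
  have hA'0 : (0 : ℝ) < 30 / 13 + ε := by positivity
  -- thresholds in `T`
  obtain ⟨T₂, hT₂⟩ :=
    (hcount.and (eventually_ge_atTop (max (max T₀ T₁) (Real.exp 1)))).exists_forall_of_atTop
  -- thresholds in `x` (through `u = log x`)
  have hE1 := eventually_affine_log_rpow_le (Real.log (4 * C₂)) 1 A (p := 1) (q := 1 / 4)
    (κ := 1 / 15) one_pos (by norm_num) (by norm_num)
  have hE2 := eventually_affine_log_rpow_le (Real.log (8 * Real.exp 1 * max C 1 / ε)) (max B 0) A
    (p := 2 / 7) (q := 1 / 4) (κ := c * ε / 2) (by norm_num) (by norm_num) (by positivity)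
  obtain ⟨x₀, hx₀⟩ := ((Real.tendsto_log_atTop.eventually (hE1.and (hE2.and
    (eventually_ge_atTop (1 : ℝ))))).and (eventually_ge_atTop (3 : ℝ))).exists_forall_of_atTop
  refine ⟨max T₂ 1, x₀, le_max_right _ _, fun x hx T hT hTx ↦ ?_⟩
  obtain ⟨⟨hE1x, hE2x, hlogx1⟩, hx3⟩ := hx₀ x hx
  obtain ⟨hcountT, hTmax⟩ := hT₂ T ((le_max_left _ _).trans hT)
  have hT₀T : T₀ ≤ T := (le_max_left _ _).trans ((le_max_left _ _).trans hTmax)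
  have hT₁T : T₁ ≤ T := (le_max_right _ _).trans ((le_max_left _ _).trans hTmax)
  have hTe : Real.exp 1 ≤ T := (le_max_right _ _).trans hTmax
  have hT1 : 1 ≤ T := (le_max_right _ _).trans hT
  have hT0 : 0 < T := by linarith
  have hlogT1 : 1 ≤ Real.log T := by rwa [Real.le_log_iff_exp_le hT0]
  have hx1 : 1 < x := by linarith
  have hx0 : 0 < x := by linarith
  have hu0 : 0 < Real.log x := by linarith
  -- `T ≤ x^{13/30 − ε/2} ≤ x^{13/30} ≤ x`
  have hTx' : T ≤ x ^ (13 / 30 : ℝ) :=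
    hTx.trans (Real.rpow_le_rpow_of_exponent_le hx1.le (by linarith))
  have hTx1 : T ≤ x := hTx'.trans (by
    conv_rhs => rw [← Real.rpow_one x]
    exact Real.rpow_le_rpow_of_exponent_le hx1.le (by norm_num))
  have hlogTx : Real.log T ≤ Real.log x := Real.log_le_log hT0 hTx1
  obtain ⟨hηhalf, hZFT⟩ := hZF T hT₁T
  -- the density bound at this `T` with the cleaned constants
  have hN' : ∀ α : ℝ, 1 / 2 ≤ α → α ≤ 1 → (zetaZeroCountRe α T : ℝ) ≤
      max C 1 * T ^ ((30 / 13 + ε) * (1 - α)) * Real.log T ^ max B 0 := by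
    intro α hα hα1
    have hp0 : 0 ≤ T ^ ((30 / 13 + ε) * (1 - α)) := Real.rpow_nonneg hT0.le _
    have hl0 : 0 < Real.log T ^ B := Real.rpow_pos_of_pos (by linarith) _
    calc (zetaZeroCountRe α T : ℝ) ≤ C * T ^ ((30 / 13 + ε) * (1 - α)) * Real.log T ^ B :=
          hN T hT₀T α hα hα1
      _ ≤ max C 1 * T ^ ((30 / 13 + ε) * (1 - α)) * Real.log T ^ B := by
          gcongr; exact le_max_left _ _
      _ ≤ max C 1 * T ^ ((30 / 13 + ε) * (1 - α)) * Real.log T ^ max B 0 :=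
          mul_le_mul_of_nonneg_left
            (Real.rpow_le_rpow_of_exponent_le hlogT1 (le_max_left _ _)) (by positivity)
  -- `T^{30/13+ε} ≤ x^{1−ε/2}`
  have haA : (13 / 30 - ε / 2) * (30 / 13 + ε) ≤ 1 - ε / 2 := by nlinarith
  have hBxle : T ^ (30 / 13 + ε) ≤ x ^ (1 - ε / 2) := by
    calc T ^ (30 / 13 + ε) ≤ (x ^ (13 / 30 - ε / 2)) ^ (30 / 13 + ε) :=
          Real.rpow_le_rpow hT0.le hTx hA'0.le
      _ = x ^ ((13 / 30 - ε / 2) * (30 / 13 + ε)) := by rw [← Real.rpow_mul hx0.le]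
      _ ≤ x ^ (1 - ε / 2) := Real.rpow_le_rpow_of_exponent_le hx1.le haA
  have hη0 : 0 ≤ c / Real.log T ^ (5 / 7 : ℝ) := by positivity
  -- the two parts
  have h2 := sum_filter_half_le hx1 hT1 hA'0 hC'0 hε hη0 hηhalf hBxle hN' hZFT
  have h1 := sum_filter_lt_half_le hx1.le T
  rw [← Finset.sum_filter_add_sum_filter_not _ (fun ρ : ℂ ↦ (1 : ℝ) / 2 ≤ ρ.re)]
  -- bound part 2 by `(4eC'/ε) u^{B'} exp(−(cε/2) u^{2/7})`, then by `e^{−u^{1/4}}/2`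
  have hdec : Real.exp (-(ε / 2 * (c / Real.log T ^ (5 / 7 : ℝ)) * Real.log x)) ≤
      Real.exp (-(c * ε / 2) * Real.log x ^ (2 / 7 : ℝ)) := by
    refine Real.exp_le_exp.2 ?_
    have h4 : c / Real.log x ^ (5 / 7 : ℝ) ≤ c / Real.log T ^ (5 / 7 : ℝ) :=
      div_le_div_of_nonneg_left hc.le (Real.rpow_pos_of_pos (by linarith) _)
        (Real.rpow_le_rpow (by linarith) hlogTx (by norm_num))
    have h5 : c / Real.log x ^ (5 / 7 : ℝ) * Real.log x = c * Real.log x ^ (2 / 7 : ℝ) := by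
      rw [div_mul_eq_mul_div, mul_div_assoc]
      congr 1
      rw [div_eq_iff (Real.rpow_pos_of_pos hu0 _).ne', ← Real.rpow_add hu0]
      norm_num
    have h6 := mul_le_mul_of_nonneg_right h4 hu0.le
    rw [h5] at h6
    nlinarith
  have hP2 : Real.exp 1 * (2 * max C 1 * Real.log T ^ max B 0) *
      Real.exp (-(ε / 2 * (c / Real.log T ^ (5 / 7 : ℝ)) * Real.log x)) * (2 / ε) ≤
      Real.exp (-(A * Real.log x ^ (1 / 4 : ℝ))) / 2 := by
    have hlogpow : Real.log T ^ max B 0 ≤ Real.log x ^ max B 0 :=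
      Real.rpow_le_rpow (by linarith) hlogTx hB'0
    calc Real.exp 1 * (2 * max C 1 * Real.log T ^ max B 0) *
          Real.exp (-(ε / 2 * (c / Real.log T ^ (5 / 7 : ℝ)) * Real.log x)) * (2 / ε)
        ≤ Real.exp 1 * (2 * max C 1 * Real.log x ^ max B 0) *
          Real.exp (-(c * ε / 2) * Real.log x ^ (2 / 7 : ℝ)) * (2 / ε) := by
          gcongr
      _ = 4 * Real.exp 1 * max C 1 / ε * Real.log x ^ max B 0 *
          Real.exp (-(c * ε / 2) * Real.log x ^ (2 / 7 : ℝ)) := by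
          field_simp; ring
      _ ≤ Real.exp (-(A * Real.log x ^ (1 / 4 : ℝ))) / 2 := highZeros_numeric hC'0 hε hu0 hE2x
  have hP1 : 2 * (zetaZeroCount T : ℝ) * x ^ (-(1 / 2 : ℝ)) ≤
      Real.exp (-(A * Real.log x ^ (1 / 4 : ℝ))) / 2 := by
    have h3 : x ^ (-(1 / 2 : ℝ)) * T ≤ Real.exp (-(1 / 15) * Real.log x) := by
      calc x ^ (-(1 / 2 : ℝ)) * T ≤ x ^ (-(1 / 2 : ℝ)) * x ^ (13 / 30 : ℝ) :=
            mul_le_mul_of_nonneg_left hTx' (Real.rpow_nonneg hx0.le _)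
        _ = Real.exp (-(1 / 15) * Real.log x) := by
            rw [← Real.rpow_add hx0, Real.rpow_def_of_pos hx0]; ring_nf
    have hlogT0 : 0 ≤ Real.log T := by linarith
    calc 2 * (zetaZeroCount T : ℝ) * x ^ (-(1 / 2 : ℝ))
        ≤ 2 * (C₂ * T * Real.log T) * x ^ (-(1 / 2 : ℝ)) := by gcongr
      _ = 2 * C₂ * (x ^ (-(1 / 2 : ℝ)) * T) * Real.log T := by ring
      _ ≤ 2 * C₂ * Real.exp (-(1 / 15) * Real.log x) * Real.log x := by gcongr
      _ ≤ Real.exp (-(A * Real.log x ^ (1 / 4 : ℝ))) / 2 := lowZeros_numeric hC₂ hu0 hE1x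
  linarith [h2.trans hP2, h1.trans hP1]

/-- **The density side of Guth–Maynard §13.2, in the form shared by Corollaries 1.3 and 1.4**
(the "`SIG`" agreed on the rh-crit/gm bus, t5 02:31Z): under the combined zero-density bound
`N(σ,T) ≤ C T^{(30/13+η)(1−σ)}(log T)^B` on `[1/2,1]` (every `η > 0`; Guth–Maynard (13.4), the
tree's `zetaZeroCountRe_le_combined`), for every `ε > 0` and every `A`,
`∑_{ρ ∈ weilZeroIndex T} m(ρ) Z^{Re ρ − 1} ≤ C exp(−A (log Z)^{1/4})` for `Z ≥ Z₀` and all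
`T ≤ Z^{13/30 − ε}` (here with `C = 1`; no lower bound on `T` is needed since the index sets
increase with `T`). Corollary 1.3 uses `Z = x`, Corollary 1.4 uses `Z = X²`
("`sup_σ X^{2σ+1}N(σ,T) ≪ X³ sup_{σ ≤ 1−c(log T)^{−5/7}} (T^{30/13+o(1)}/X²)^{1−σ}`").
[cite: GuthMaynard2026, §13.2] -/
theorem zeroSum_rpow_decay
    (hcomb : ∀ η : ℝ, 0 < η → ∃ C B T₀ : ℝ, ∀ T : ℝ, T₀ ≤ T → ∀ σ : ℝ, 1 / 2 ≤ σ → σ ≤ 1 →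
      (zetaZeroCountRe σ T : ℝ) ≤ C * T ^ ((30 / 13 + η) * (1 - σ)) * Real.log T ^ B)
    {ε : ℝ} (hε : 0 < ε) (A : ℝ) :
    ∃ C Z₀ : ℝ, ∀ Z : ℝ, Z₀ ≤ Z → ∀ T : ℝ, T ≤ Z ^ (13 / 30 - ε) →
      ∑ ρ ∈ (weilZeroIndex_finite T).toFinset, (riemannZetaZeroOrder ρ : ℝ) * Z ^ (ρ.re - 1) ≤
        C * Real.exp (-A * Real.log Z ^ (1 / 4 : ℝ)) := by
  classical
  set ε₀ : ℝ := min (2 * ε) (1 / 10) with hε₀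
  have hε₀0 : 0 < ε₀ := lt_min (by linarith) (by norm_num)
  have hε₀1 : ε₀ ≤ 1 / 10 := min_le_right _ _
  have hε₀ε : ε₀ / 2 ≤ ε := by
    have := min_le_left (2 * ε) (1 / 10); rw [← hε₀] at this; linarith
  obtain ⟨T₂, x₀, hT₂1, h⟩ := zeroSum_le_of_density hcomb hε₀0 hε₀1 A
  -- `Z₀`: beyond `x₀`, `1`, and large enough that `T₂ ≤ Z^{13/30 − ε₀/2}`
  have hev : ∀ᶠ Z : ℝ in atTop, T₂ ≤ Z ^ (13 / 30 - ε₀ / 2) :=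
    (tendsto_rpow_atTop (by linarith : (0 : ℝ) < 13 / 30 - ε₀ / 2)).eventually_ge_atTop T₂
  obtain ⟨Z₀, hZ₀⟩ := (hev.and ((eventually_ge_atTop x₀).and (eventually_gt_atTop (1 : ℝ)))).exists_forall_of_atTop
  refine ⟨1, Z₀, fun Z hZ T hT ↦ ?_⟩
  obtain ⟨hT₂Z, hx₀Z, hZ1⟩ := hZ₀ Z hZ
  rw [one_mul, neg_mul]
  have hmono : Z ^ (13 / 30 - ε) ≤ Z ^ (13 / 30 - ε₀ / 2) :=
    Real.rpow_le_rpow_of_exponent_le hZ1.le (by linarith)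
  rcases le_or_gt T₂ T with hT₂T | hTlt
  · exact h Z hx₀Z T hT₂T (hT.trans hmono)
  · -- few zeros: enlarge the index set to height `T₂`
    have hsub : (weilZeroIndex_finite T).toFinset ⊆ (weilZeroIndex_finite T₂).toFinset := by
      intro ρ hρ
      rw [Set.Finite.mem_toFinset] at hρ ⊢
      obtain ⟨h0, h1, h2, h3, h4⟩ := hρ
      exact ⟨h0, h1, h2, h3, h4.trans hTlt.le⟩
    refine le_trans (Finset.sum_le_sum_of_subset_of_nonneg hsub fun ρ hρ _ ↦ ?_) (h Z hx₀Z T₂ le_rfl hT₂Z)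
    rw [Set.Finite.mem_toFinset] at hρ
    exact mul_nonneg (riemannZetaZeroOrder_nonneg_of_zero hρ.1) (Real.rpow_nonneg (by linarith) _)

end GuthMaynard2026
end Literature.NumberTheory.LFunctions
end
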